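import Mathlib.LinearAlgebra.Matrix.PosDef
import Mathlib.LinearAlgebra.Matrix.Hadamard
import Mathlib.Analysis.Matrix.Order
import Mathlib.Analysis.SpecialFunctions.Pow.Real
import Literature.Combinatorics.SimpleGraph.LasserreStableBound

/-!
# Route RamseyUncertifiable, crux `SosUncertainty` (stmt-PneNP-9815): vocabulary of the line
`hadamard-bessel-defect` (definitions)

Objects posited by the line `hadamard-bessel-defect` for the crux
`Summit.PneNP.PneNP.Theses.RamseyUncertifiable.SosUncertainty` (skeleton
`Summits/PneNP/PneNP/Cruxes/SosUncertainty/Lines/hadamard_bessel_defect.lean`, whose registered stubs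
are stated in exactly this vocabulary and namespace):

* `Idx W t` — the index type `P_t(W) = {S ⊆ W : |S| ≤ t}` of Laurent's moment matrix `M_t(y)`
  (`Literature.Combinatorics.SimpleGraph.momentMatrix`);
* `unionSum Q U = Σ_{I ∪ J = U} Q_{IJ}` — the coefficient of `y_U` in `⟨Q, M_t(y)⟩`;
* `IsCertificate G t w Q` — a level-`t` SoS CERTIFICATE that `Σ_v w_v y_v ≤ 1` on the level-`t` Lasserre
  body of Laurent's program (22): `Q ⪰ 0` on `P_t(V)` with union sums `1` at `∅`, `−w_v` at `{v}`, `0`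
  at every stable `U` with `|U| ≥ 2` (free at non-stable `U`: the conic dual of (22) with the redundant
  ideal constraints `y_U = 0`, `U` non-stable, added; Laurent 2006 §3.1);
* `vtx`, `vtxEntry Q u v = Q_{{u},{v}}` — the singleton block (junk `0` at level `0`);
* `cosMatrix Q` — the singleton cosine matrix `C_uv = Q_uv / √(Q_uu Q_vv)`;
* `DefectBound t γ n G` — the Hadamard–Bessel defect bound for one graph: every certifiable pair of
  nonnegative constant weights `(a, b)` for `(G, Gᶜ)` at level `t` admits a certificate pair with
  `n^γ • 1 − cosMatrix Q ⊙ cosMatrix Q' ⪰ 0`.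

A short API is proved here because every stub of the line uses it: `unionSum_eq_zero_of_card_lt`
(union sums vanish above `2t`) and weak duality `IsCertificate.sound` (a certificate certifies:
`Σ_v w_v y_v ≤ 1` for every level-`t` feasible `y`, via Mathlib's Schur product theorem
`Matrix.PosSemidef.hadamard`), which pins the polarity of `IsCertificate`. Definitions and elementary
lemmas only; no fact is asserted. The stubs and the composition live in the skeleton and land as
`RamseyUncertifiableSosUncertainty*.lean`. [folklore]
-/

noncomputable section

open scoped BigOperators Matrix

namespace Summit.PneNP.PneNP.Cruxes.SosUncertainty.HadamardBesselDefect

open Finset Matrix Literature.Combinatorics.SimpleGraph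

set_option linter.dupNamespace false -- `Summit.PneNP.PneNP.…`: summit = sub-problem name (single-conjunct summit, D-0017)

/-- The index type `P_t(W) = {S ⊆ W : |S| ≤ t}` of Laurent's moment matrix `M_t(y)`
(`Literature.Combinatorics.SimpleGraph.momentMatrix`), reused for certificates. [folklore] -/
abbrev Idx (W : Type*) (t : ℕ) : Type _ := {S : Finset W // S.card ≤ t}

variable {V : Type*} [Fintype V] [DecidableEq V]

/-- Union sums of a matrix on `P_t(V)`: `unionSum Q U = Σ_{I ∪ J = U} Q_{IJ}` — the coefficient of
`y_U` in `⟨Q, M_t(y)⟩`. [folklore] -/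
def unionSum {t : ℕ} (Q : Matrix (Idx V t) (Idx V t) ℝ) (U : Finset V) : ℝ :=
  ∑ I : Idx V t, ∑ J : Idx V t, if I.1 ∪ J.1 = U then Q I J else 0

/-- **Level-`t` SoS certificate** that `Σ_v w_v y_v ≤ 1` on the Lasserre body of program (22):
`Q ⪰ 0` on `P_t(V)` with union sums `1` at `∅`, `−w_v` at `{v}`, `0` at stable `U`, `|U| ≥ 2`
(free at non-stable `U` — the dual with redundant ideal constraints; Laurent 2006 §3.1). In SoS
language: `1 − Σ_v w_v x_v ≡ mᵀ Q m` modulo the stable-set ideal, `m` the vector of monomials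
`x_S`, `|S| ≤ t`. [cite: Laurent2006, §3.1 (22)] -/
structure IsCertificate (G : SimpleGraph V) (t : ℕ) (w : V → ℝ)
    (Q : Matrix (Idx V t) (Idx V t) ℝ) : Prop where
  /-- `Q ⪰ 0` -/
  posSemidef : Q.PosSemidef
  /-- constant coefficient: `Q_∅∅ = 1` -/
  empty : unionSum Q ∅ = 1
  /-- `x_v`-coefficient: `2 Q_{∅v} + Q_{vv} = −w_v` -/
  singleton : ∀ v : V, unionSum Q {v} = -w v
  /-- coefficients of stable monomials of degree `≥ 2` vanish -/
  indep : ∀ U : Finset V, 2 ≤ U.card → G.IsIndepSet (U : Set V) → unionSum Q U = 0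

omit [Fintype V] in
/-- The singleton `{v}` as a level-`t` index (`1 ≤ t`). [folklore] -/
def vtx (t : ℕ) (ht : 1 ≤ t) (v : V) : Idx V t :=
  ⟨{v}, by rw [Finset.card_singleton]; exact ht⟩

omit [Fintype V] in
/-- The singleton block of `Q`: `vtxEntry Q u v = Q_{{u},{v}}` (junk `0` at level `0`). [folklore] -/
def vtxEntry {t : ℕ} (Q : Matrix (Idx V t) (Idx V t) ℝ) (u v : V) : ℝ :=
  if ht : 1 ≤ t then Q (vtx t ht u) (vtx t ht v) else 0

omit [Fintype V] in
/-- **Singleton cosine matrix** of a certificate: `C_uv = Q_uv / √(Q_uu Q_vv) = cos∠(r_u, r_v)` for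
Gram vectors `r_S` of `Q` (row `u` is `0` when `r_u = 0`, by `x / 0 = 0`). The line's one object is
the Hadamard product `cosMatrix Q ⊙ cosMatrix Q'` of a certificate pair for `(G, Gᶜ)`. [folklore] -/
def cosMatrix {t : ℕ} (Q : Matrix (Idx V t) (Idx V t) ℝ) : Matrix V V ℝ :=
  Matrix.of fun u v => vtxEntry Q u v / (Real.sqrt (vtxEntry Q u u) * Real.sqrt (vtxEntry Q v v))

/-- **The defect bound HB_t(γ) for one graph**: every certifiable pair of nonnegative CONSTANT weights
`(a, b)` for `(G, Gᶜ)` at level `t` admits a certificate pair whose singleton cosine matrices satisfy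
`n^γ • 1 − cosMatrix Q ⊙ cosMatrix Q' ⪰ 0`, i.e. `λ_max(C ⊙ C') ≤ n^γ`. Existential over
certificates (the universal form is false already on `Ē_n`); by mixing with the trivial certificate
`E_∅∅` its content is the canonical pair `a = 1/las_t(G)`, `b = 1/las_t(Gᶜ)`. A predicate (data
`t γ n G`), not an asserted fact. [folklore] -/
def DefectBound (t : ℕ) (γ : ℝ) (n : ℕ) (G : SimpleGraph (Fin n)) : Prop :=
  ∀ a b : ℝ, 0 ≤ a → 0 ≤ b →
    (∃ Q : Matrix (Idx (Fin n) t) (Idx (Fin n) t) ℝ, IsCertificate G t (fun _ => a) Q) →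
    (∃ Q' : Matrix (Idx (Fin n) t) (Idx (Fin n) t) ℝ, IsCertificate Gᶜ t (fun _ => b) Q') →
      ∃ Q Q' : Matrix (Idx (Fin n) t) (Idx (Fin n) t) ℝ,
        IsCertificate G t (fun _ => a) Q ∧ IsCertificate Gᶜ t (fun _ => b) Q' ∧
        (((n : ℝ) ^ γ) • (1 : Matrix (Fin n) (Fin n) ℝ) - cosMatrix Q ⊙ cosMatrix Q').PosSemidef

/-! ### Elementary API (proved): vanishing above `2t`, weak duality -/

/-- Union sums vanish above `2t`: no two level-`t` indices have a union of size `> 2t`. [folklore] -/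
theorem unionSum_eq_zero_of_card_lt {t : ℕ} (Q : Matrix (Idx V t) (Idx V t) ℝ)
    {U : Finset V} (hU : 2 * t < U.card) : unionSum Q U = 0 := by
  unfold unionSum
  refine Finset.sum_eq_zero fun I _ => Finset.sum_eq_zero fun J _ => ?_
  rw [if_neg]
  intro hIJ
  have h1 : (I.1 ∪ J.1).card ≤ I.1.card + J.1.card := Finset.card_union_le _ _
  have h2 := I.2
  have h3 := J.2
  rw [hIJ] at h1
  omega

/-- **Weak duality / soundness** (the polarity check of `IsCertificate`): a level-`t` certificate for
`(G, w)` proves `Σ_v w_v y_v ≤ 1` for every level-`t` feasible `y` of program (22). Proof: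
`0 ≤ 𝟙ᵀ (Q ⊙ M_t(y)) 𝟙` (Schur product theorem, Mathlib `Matrix.PosSemidef.hadamard`)
`= Σ_{I,J} Q_{IJ} y_{I∪J} = Σ_U (Σ_{I∪J=U} Q_{IJ}) y_U = 1 − Σ_v w_v y_v`, using `y_U = 0` on
non-stable `U` with `|U| ≤ 2t` (`IsLasserreFeasible.apply_eq_zero_of_not_isIndepSet`). [folklore] -/
theorem IsCertificate.sound {G : SimpleGraph V} {t : ℕ} {w : V → ℝ}
    {Q : Matrix (Idx V t) (Idx V t) ℝ} (hQ : IsCertificate G t w Q)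
    {y : Finset V → ℝ} (hy : IsLasserreFeasible G t y) : ∑ v, w v * y {v} ≤ 1 := by
  -- (1) Schur: `Q ⊙ M_t(y) ⪰ 0`, tested against the all-ones vector
  have hH : (Q ⊙ momentMatrix t y).PosSemidef := hQ.posSemidef.hadamard hy.posSemidef
  have h0 := hH.dotProduct_mulVec_nonneg (fun _ => 1)
  have h1 : star (fun _ : Idx V t => (1 : ℝ)) ⬝ᵥ ((Q ⊙ momentMatrix t y) *ᵥ fun _ => 1)
      = ∑ I : Idx V t, ∑ J : Idx V t, Q I J * y (I.1 ∪ J.1) := by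
    simp [dotProduct, Matrix.mulVec, Matrix.hadamard_apply, momentMatrix_apply]
  -- (2) regroup by the union `U = I ∪ J`
  have h2 : ∑ I : Idx V t, ∑ J : Idx V t, Q I J * y (I.1 ∪ J.1)
      = ∑ U : Finset V, unionSum Q U * y U := by
    have hpt : ∀ I J : Idx V t, Q I J * y (I.1 ∪ J.1)
        = ∑ U : Finset V, if I.1 ∪ J.1 = U then Q I J * y U else 0 := by
      intro I J
      rw [Finset.sum_ite_eq]
      simp
    simp_rw [hpt]
    have hin : ∀ I : Idx V t, (∑ J : Idx V t, ∑ U : Finset V,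
        if I.1 ∪ J.1 = U then Q I J * y U else 0)
        = ∑ U : Finset V, ∑ J : Idx V t, if I.1 ∪ J.1 = U then Q I J * y U else 0 :=
      fun I => Finset.sum_comm
    simp_rw [hin]
    rw [Finset.sum_comm]
    refine Finset.sum_congr rfl fun U _ => ?_
    unfold unionSum
    rw [Finset.sum_mul]
    refine Finset.sum_congr rfl fun I _ => ?_
    rw [Finset.sum_mul]
    refine Finset.sum_congr rfl fun J _ => ?_
    split_ifs <;> simp
  -- (3) evaluate each union sum
  have hne : ∀ v : V, (∅ : Finset V) ≠ {v} := fun v h => Finset.singleton_ne_empty v h.symm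
  have h3 : ∀ U : Finset V, unionSum Q U * y U
      = (if U = ∅ then (1 : ℝ) else 0) - ∑ v, (if U = {v} then w v * y {v} else 0) := by
    intro U
    by_cases hU0 : U = ∅
    · subst hU0
      simp [hQ.empty, hy.empty_eq_one, hne]
    by_cases hU1 : ∃ v, U = {v}
    · obtain ⟨v, rfl⟩ := hU1
      rw [hQ.singleton v, if_neg (Finset.singleton_ne_empty v)]
      simp only [Finset.singleton_inj]
      rw [Fintype.sum_ite_eq v (fun u => w u * y {u})]
      ring
    · have hcard : 2 ≤ U.card := by
        by_contra hlt
        have h01 : U.card = 0 ∨ U.card = 1 := by omega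
        rcases h01 with h | h
        · exact hU0 (Finset.card_eq_zero.1 h)
        · obtain ⟨v, hv⟩ := Finset.card_eq_one.1 h
          exact hU1 ⟨v, hv⟩
      have hrhs : (if U = ∅ then (1 : ℝ) else 0) - ∑ v, (if U = {v} then w v * y {v} else 0) = 0 := by
        rw [if_neg hU0, Finset.sum_eq_zero, sub_zero]
        intro v _
        rw [if_neg]
        intro h
        exact hU1 ⟨v, h⟩
      rw [hrhs]
      by_cases hst : G.IsIndepSet (U : Set V)
      · rw [hQ.indep U hcard hst, zero_mul]
      · by_cases hle : U.card ≤ 2 * t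
        · rw [hy.apply_eq_zero_of_not_isIndepSet hle hst, mul_zero]
        · rw [unionSum_eq_zero_of_card_lt Q (by omega), zero_mul]
  -- (4) sum up
  have h4 : ∑ U : Finset V, unionSum Q U * y U = 1 - ∑ v, w v * y {v} := by
    simp_rw [h3]
    rw [Finset.sum_sub_distrib, Fintype.sum_ite_eq' (∅ : Finset V) (fun _ => (1 : ℝ)),
      Finset.sum_comm]
    congr 1
    refine Finset.sum_congr rfl fun v _ => ?_
    rw [Fintype.sum_ite_eq' ({v} : Finset V) (fun _ => w v * y {v})]
  rw [h1, h2, h4] at h0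
  linarith

/-- Vocabulary anchor (registered sub-goal `defs_anchor` of stmt-PneNP-9815): the Defs file of the
line is credited through this restatement of weak duality `IsCertificate.sound` in closed `∀`-form.
[folklore] -/
theorem defs_anchor :
    ∀ (n t : ℕ) (G : SimpleGraph (Fin n)) (w : Fin n → ℝ)
      (Q : Matrix (Idx (Fin n) t) (Idx (Fin n) t) ℝ) (y : Finset (Fin n) → ℝ),
      IsCertificate G t w Q → IsLasserreFeasible G t y → ∑ v, w v * y {v} ≤ 1 :=
  fun _ _ _ _ _ _ hQ hy => hQ.sound hy

end Summit.PneNP.PneNP.Cruxes.SosUncertainty.HadamardBesselDefect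

end
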